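import Mathlib
import Summits.Ventures.PercRepro2.Defs
import Summits.Ventures.PercRepro2.Graph
import Summits.Ventures.PercRepro2.OneColourSwitch
import Summits.Ventures.PercRepro2.RegionHubSign
import Summits.Ventures.PercRepro2.SideSwitch
import Summits.Ventures.PercRepro2.M9NoPocketDefs
import Summits.Ventures.PercRepro2.M9GeneralDHD
import Summits.Ventures.PercRepro2.M9PocketRSEdgeTransfer
import Summits.Ventures.PercRepro2.M9PocketRootOnlyTransfer
import Summits.Ventures.PercRepro2.M9PocketRSDTransfer
import Summits.Ventures.PercRepro2.M9PocketRSDJoin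
import Summits.Ventures.PercRepro2.M9PocketRSDWorlds

/-!
# A cluster hanging from `{r, s, d}` — defect, `σ_pq`, `W`-link (blind cell PercRepro2,
p3 g42, 2026-08-30; `proofs/P3-POCKETRK.md` §10⁶ (a) (iv)–(vi))

At a `K`-only point (`d ∈ K₂ ∖ M₂`) of a graph with a cluster `L` hanging from `{r, s, d}`:
the `W`-defect of `d` is the outside defect (read with the `Y`-world of the three exits in
`G − F`) or a dead end inside the `F`-graph (`WDefect_iff_rsd`); at a `Sep` point `σ_pq` is
that of `G − F` — a `Y`-path from `p` never reaches an exit, a `W`-path from `p` through `d`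
returns to `d` (`conn_pq_iff_rsd`, `conn_compl_pq_iff_rsd`, `sigma_pq_eq_rsd`); and the
`W`-link `r ~_W s` has no passage through `d` (`conn_compl_rs_iff_rsd`).  Own work; std axioms.
-/

namespace Summit.Ventures.PercRepro2

namespace NoPocket

open Finset Classical OneColourSwitch SideSwitch

variable {V : Type*} {E : Type*} {ends : E → Sym2 V} {p q r s d : V} {ω : Config E} {L : Set V}

section GlueRSD

variable (hL : ∀ e x y, ends e = s(x, y) → x ∈ L → y ∈ L ∨ y = r ∨ y = s ∨ y = d)
  (hr : r ∉ L) (hs : s ∉ L) (hd : d ∉ L)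

include hL hr hs hd in
/-- **The `W`-defect at a `K`-only point**: the outside defect, or a dead end inside `F`. -/
lemma WDefect_iff_rsd (hK : d ∈ K2 ends r s ω) (hM : d ∉ M2 ends r s ω) (hp : p ∉ L)
    (hq : q ∉ L) :
    WDefect ends p q r s d ω ↔
      (Conn (fun e : {e // e ∉ within ends (L ∪ {r, s, d} : Set V)} => ends e.1)
          (OneColourSwitch.compl (fun e => ω e.1)) d p ∨
        Conn (fun e : {e // e ∉ within ends (L ∪ {r, s, d} : Set V)} => ends e.1)
          (OneColourSwitch.compl (fun e => ω e.1)) d q ∨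
        ∃ x, x ≠ r ∧ x ≠ s ∧ x ≠ d ∧ x ∉ L ∧
          (Conn (fun e : {e // e ∉ within ends (L ∪ {r, s, d} : Set V)} => ends e.1)
              (fun e => ω e.1) r x ∨
            Conn (fun e : {e // e ∉ within ends (L ∪ {r, s, d} : Set V)} => ends e.1)
              (fun e => ω e.1) s x ∨
            Conn (fun e : {e // e ∉ within ends (L ∪ {r, s, d} : Set V)} => ends e.1)
              (fun e => ω e.1) d x) ∧
          Conn (fun e : {e // e ∉ within ends (L ∪ {r, s, d} : Set V)} => ends e.1)
            (OneColourSwitch.compl (fun e => ω e.1)) d x) ∨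
      (∃ x ∈ L,
        (Conn (fun e : {e // ¬ (e ∉ within ends (L ∪ {r, s, d} : Set V))} => ends e.1)
            (fun e => ω e.1) r x ∨
          Conn (fun e : {e // ¬ (e ∉ within ends (L ∪ {r, s, d} : Set V))} => ends e.1)
            (fun e => ω e.1) s x ∨
          Conn (fun e : {e // ¬ (e ∉ within ends (L ∪ {r, s, d} : Set V))} => ends e.1)
            (fun e => ω e.1) d x) ∧
        Conn (fun e : {e // ¬ (e ∉ within ends (L ∪ {r, s, d} : Set V))} => ends e.1)
          (OneColourSwitch.compl (fun e => ω e.1)) d x) := by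
  unfold WDefect
  constructor
  · rintro (h | h | ⟨x, hxr, hxs, hxd, hxK, hxW⟩)
    · exact Or.inl (Or.inl ((conn_compl_d_restrict_iff_rsd hL hr hs hd hM hp).1 h))
    · exact Or.inl (Or.inr (Or.inl ((conn_compl_d_restrict_iff_rsd hL hr hs hd hM hq).1 h)))
    · by_cases hxL : x ∈ L
      · exact Or.inr ⟨x, hxL, (mem_K2_F_iff_of_mem_rsd hL hr hs hd hK hxL).1 hxK,
          (conn_compl_d_F_iff_rsd hL hr hs hd hM hxL).1 hxW⟩
      · exact Or.inl (Or.inr (Or.inr ⟨x, hxr, hxs, hxd, hxL,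
          (mem_K2_restrict_iff_of_notMem_rsd hL hr hs hd hK hxL).1 hxK,
          (conn_compl_d_restrict_iff_rsd hL hr hs hd hM hxL).1 hxW⟩))
  · rintro ((h | h | ⟨x, hxr, hxs, hxd, hxL, hxK, hxW⟩) | ⟨x, hxL, hxK, hxW⟩)
    · exact Or.inl ((conn_compl_d_restrict_iff_rsd hL hr hs hd hM hp).2 h)
    · exact Or.inr (Or.inl ((conn_compl_d_restrict_iff_rsd hL hr hs hd hM hq).2 h))
    · exact Or.inr (Or.inr ⟨x, hxr, hxs, hxd,
        (mem_K2_restrict_iff_of_notMem_rsd hL hr hs hd hK hxL).2 hxK,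
        (conn_compl_d_restrict_iff_rsd hL hr hs hd hM hxL).2 hxW⟩)
    · have hxr : x ≠ r := fun h' => hr (h' ▸ hxL)
      have hxs : x ≠ s := fun h' => hs (h' ▸ hxL)
      have hxd : x ≠ d := fun h' => hd (h' ▸ hxL)
      exact Or.inr (Or.inr ⟨x, hxr, hxs, hxd, (mem_K2_F_iff_of_mem_rsd hL hr hs hd hK hxL).2 hxK,
        (conn_compl_d_F_iff_rsd hL hr hs hd hM hxL).2 hxW⟩)

include hL hr hs hd in
/-- **`p ~_Y q` at a `Sep` point is a `Y`-connection of `G − F`**: a `Y`-path from `p` never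
reaches an exit (all exits are `Y`-reached). -/
lemma conn_pq_iff_rsd (hK : d ∈ K2 ends r s ω) (hsep : sep2 ends p q r s ω) (hp : p ∉ L) :
    Conn ends ω p q ↔
      Conn (fun e : {e // e ∉ within ends (L ∪ {r, s, d} : Set V)} => ends e.1) (fun e => ω e.1)
        p q := by
  constructor
  · intro h
    refine mem_of_conn_of_closed (S := {z |
      Conn (fun e : {e // e ∉ within ends (L ∪ {r, s, d} : Set V)} => ends e.1) (fun e => ω e.1)
        p z}) ?_ (conn_refl _ _ _) h
    intro a ha b hab
    simp only [Set.mem_setOf_eq] at ha ⊢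
    obtain ⟨_, e, he, hends⟩ := openGraph_adj.1 hab
    by_cases hP : e ∈ within ends (L ∪ {r, s, d} : Set V)
    · -- the path would enter `F` at an exit: `p` would be `Y`-reached
      exfalso
      have haL : a ∉ L := notMem_L_of_conn_restrict_rsd hL hp ha
      have haE := exit_of_mem_of_notMem (mem_of_mem_within hP hends).1 haL
      have hpa : Conn ends ω p a := conn_of_conn_restrict ha
      have hpK : p ∈ K2 ends r s ω := by
        rcases haE with rfl | rfl | rfl
        · exact mem_K2_of_conn_of_mem (r_mem_K2 _ _ _) (conn_symm hpa)
        · exact mem_K2_of_conn_of_mem (s_mem_K2 _ _ _) (conn_symm hpa)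
        · exact mem_K2_of_conn_of_mem hK (conn_symm hpa)
      rcases mem_K2_iff.1 hpK with h' | h'
      · exact hsep.1.1 (conn_symm h')
      · exact hsep.1.2.1 (conn_symm h')
    · exact conn_trans ha (conn_of_openAdj ⟨⟨e, hP⟩, he, hends⟩)
  · exact conn_of_conn_restrict

include hL hr hs hd in
/-- **`p ~_W q` at a `K`-only `Sep` point is a `W`-connection of `G − F`**: a `W`-path from
`p` enters `F` only at `d` and returns to `d`. -/
lemma conn_compl_pq_iff_rsd (hK : d ∈ K2 ends r s ω) (hM : d ∉ M2 ends r s ω)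
    (hsep : sep2 ends p q r s ω) (hp : p ∉ L) (hq : q ∉ L) :
    Conn ends (OneColourSwitch.compl ω) p q ↔
      Conn (fun e : {e // e ∉ within ends (L ∪ {r, s, d} : Set V)} => ends e.1)
        (OneColourSwitch.compl (fun e => ω e.1)) p q := by
  constructor
  · intro h
    have key : q ∈ {z |
        Conn (fun e : {e // e ∉ within ends (L ∪ {r, s, d} : Set V)} => ends e.1)
          (OneColourSwitch.compl (fun e => ω e.1)) p z ∨
        (Conn (fun e : {e // e ∉ within ends (L ∪ {r, s, d} : Set V)} => ends e.1)
          (OneColourSwitch.compl (fun e => ω e.1)) p d ∧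
        Conn (fun e : {e // ¬ (e ∉ within ends (L ∪ {r, s, d} : Set V))} => ends e.1)
          (OneColourSwitch.compl (fun e => ω e.1)) d z)} := by
      refine mem_of_conn_of_closed ?_ (Or.inl (conn_refl _ _ _)) h
      intro a ha b hab
      simp only [Set.mem_setOf_eq] at ha ⊢
      obtain ⟨_, e, he, hends⟩ := openGraph_adj.1 hab
      by_cases hP : e ∈ within ends (L ∪ {r, s, d} : Set V)
      · have hadj : Conn (fun e : {e // ¬ (e ∉ within ends (L ∪ {r, s, d} : Set V))} => ends e.1)
            (OneColourSwitch.compl (fun e => ω e.1)) a b :=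
          conn_of_openAdj ⟨⟨e, not_not.2 hP⟩, he, hends⟩
        rcases ha with ha | ⟨hpd, ha⟩
        · -- `a` is an exit on a `W`-path from `p`: not `r`, `s` (`Sep`), so `d`
          have haL : a ∉ L := notMem_L_of_conn_restrict_rsd (ω := OneColourSwitch.compl ω) hL hp ha
          have haE := exit_of_mem_of_notMem (mem_of_mem_within hP hends).1 haL
          rcases haE with rfl | rfl | rfl
          · exact (hsep.2.1 (conn_of_conn_restrict (ω := OneColourSwitch.compl ω) ha)).elim
          · exact (hsep.2.2.1 (conn_of_conn_restrict (ω := OneColourSwitch.compl ω) ha)).elim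
          · exact Or.inr ⟨ha, hadj⟩
        · exact Or.inr ⟨hpd, conn_trans ha hadj⟩
      · have hadj : Conn (fun e : {e // e ∉ within ends (L ∪ {r, s, d} : Set V)} => ends e.1)
            (OneColourSwitch.compl (fun e => ω e.1)) a b :=
          conn_of_openAdj ⟨⟨e, hP⟩, he, hends⟩
        have haL : a ∉ L := (notMem_L_of_notMem_within_rsd hL hP hends).1
        rcases ha with ha | ⟨hpd, ha⟩
        · exact Or.inl (conn_trans ha hadj)
        · -- `a` on a `W`-segment of `F` from `d`, off `L`: an exit; `r`, `s` would put `d ∈ M₂`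
          have haE := exit_of_mem_of_notMem
            (mem_of_conn_F_rsd (ω := OneColourSwitch.compl ω) (by simp) ha) haL
          rcases haE with rfl | rfl | rfl
          · exfalso
            apply hM
            rw [M2, ← K2, mem_K2_iff]
            exact Or.inl (conn_symm (conn_of_conn_restrict (ω := OneColourSwitch.compl ω) ha))
          · exfalso
            apply hM
            rw [M2, ← K2, mem_K2_iff]
            exact Or.inr (conn_symm (conn_of_conn_restrict (ω := OneColourSwitch.compl ω) ha))
          · exact Or.inl (conn_trans hpd hadj)
    simp only [Set.mem_setOf_eq] at key
    rcases key with key | ⟨_, key⟩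
    · exact key
    · -- a `W`-segment of `F` from `d` ends in `L ∪ {r, s, d}`: `q` is none of these
      exfalso
      have hqE := exit_of_mem_of_notMem
        (mem_of_conn_F_rsd (ω := OneColourSwitch.compl ω) (by simp) key) hq
      rcases hqE with rfl | rfl | rfl
      · exact hsep.1.2.2.1 (conn_refl _ _ _)
      · exact hsep.1.2.2.2 (conn_refl _ _ _)
      · rcases mem_K2_iff.1 hK with h' | h'
        · exact hsep.1.2.2.1 (conn_symm h')
        · exact hsep.1.2.2.2 (conn_symm h')
  · exact fun h => conn_of_conn_restrict (ω := OneColourSwitch.compl ω) h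

include hL hr hs hd in
/-- **`σ_pq` at a `K`-only `Sep` point is that of `G − F`.** -/
lemma sigma_pq_eq_rsd (hK : d ∈ K2 ends r s ω) (hM : d ∉ M2 ends r s ω)
    (hsep : sep2 ends p q r s ω) (hp : p ∉ L) (hq : q ∉ L) :
    sigma ends ω p q =
      sigma (fun e : {e // e ∉ within ends (L ∪ {r, s, d} : Set V)} => ends e.1) (fun e => ω e.1)
        p q := by
  unfold sigma
  rw [if_congr (conn_pq_iff_rsd hL hr hs hd hK hsep hp) rfl rfl,
    if_congr (conn_compl_pq_iff_rsd hL hr hs hd hK hM hsep hp hq) rfl rfl]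

include hL hr hs hd in
/-- **The `W`-link `r ~_W s` at a `K`-only point has no passage through `d`**: it is a
`W`-segment of `G − F` or of the `F`-graph. -/
lemma conn_compl_rs_iff_rsd (hM : d ∉ M2 ends r s ω) :
    Conn ends (OneColourSwitch.compl ω) r s ↔
      Conn (fun e : {e // e ∉ within ends (L ∪ {r, s, d} : Set V)} => ends e.1)
          (OneColourSwitch.compl (fun e => ω e.1)) r s ∨
        Conn (fun e : {e // ¬ (e ∉ within ends (L ∪ {r, s, d} : Set V))} => ends e.1)
          (OneColourSwitch.compl (fun e => ω e.1)) r s := by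
  rw [conn_rs_iff_join_rsd (ω := OneColourSwitch.compl ω) hL hr hs hd]
  constructor
  · rintro (h | ⟨h1, _⟩)
    · exact h
    · exfalso
      apply hM
      rw [M2, ← K2, mem_K2_iff]
      rcases h1 with h1 | h1
      · exact Or.inl (conn_of_conn_restrict (ω := OneColourSwitch.compl ω) h1)
      · exact Or.inl (conn_of_conn_restrict (ω := OneColourSwitch.compl ω) h1)
  · exact fun h => Or.inl h

end GlueRSD

end NoPocket

end Summit.Ventures.PercRepro2
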